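import Literature.Topology.FourManifolds.PLUniquenessPieces
import HarnessLib

/-!
# Uniqueness of Whitehead-compatible PL structures: the induction and the theorem

The proof of `Literature.Topology.FourManifolds.nonempty_plHomeomorph_of_isWhiteheadCompatible`
(Munkres (1966), Thm 10.5; Whitehead (1940), Thm 8): starting from `F = G = id` (PD along the two
PL structures by Whitehead compatibility), run the stages of `PLUniquenessStage` along a family of
pieces (`PLUniquenessPieces`), with tolerances below the displacement bounds `lam j`; the orbit
lemma confines orbits to the next compact of the exhaustion, so the maps stabilise locally, the
drift hypotheses of the stages hold, and the limits `F∞, G∞` are homeomorphisms, PD along the two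
PL structures, with `F∞⁻¹ ∘ G∞` PL in both directions everywhere; `PLUniquenessGlue` turns this
into a `Structomorph` for `plGroupoid n`.

No named facts are introduced; the file ends with the discharge
`nonempty_plHomeomorph_of_isWhiteheadCompatible_holds`.

## References

* J.R. Munkres, *Elementary differential topology*, Ann. of Math. Studies 54 (1963; rev. 1966),
  §10, Thms 10.4–10.5. [Munkres1966]
* J.H.C. Whitehead, *On C¹-complexes*, Ann. of Math. 41 (1940), Thm 8. [Whitehead1940]
-/

open Set Function Metric Filter
open scoped Topology Manifold NNReal ContDiff

noncomputable section

namespace Literature.Topology.FourManifolds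

open Literature.Analysis.Convexity

local notation "𝔼 " n:arg => EuclideanSpace ℝ (Fin n)

namespace UPieces

section Levels

variable {n : ℕ} {M : Type*} [TopologicalSpace M] {cD c₁ c₂ : ChartedSpace (𝔼 n) M}
  (Pc : UPieces n M cD c₁ c₂)

/-- The level parameters `s k = 1/2 + 2^{-(k+1)}`, decreasing from `1` to `1/2`. [folklore] -/
def sl (k : ℕ) : ℝ := 1 / 2 + (1 / 2 : ℝ) ^ (k + 1)

/-- The intermediate level parameter. [folklore] -/
def smid (k : ℕ) : ℝ := (sl k + sl (k + 1)) / 2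

/-- Auxiliary (`sl_succ_lt`). [folklore] -/
theorem sl_succ_lt (k : ℕ) : sl (k + 1) < sl k := by
  unfold sl
  have : (1 / 2 : ℝ) ^ (k + 1 + 1) < (1 / 2) ^ (k + 1) := pow_lt_pow_right_of_lt_one₀ (by norm_num) (by norm_num) (by omega)
  linarith

/-- Auxiliary (`half_lt_sl`). [folklore] -/
theorem half_lt_sl (k : ℕ) : 1 / 2 < sl k := by
  unfold sl; have : (0 : ℝ) < (1 / 2) ^ (k + 1) := by positivity
  linarith

/-- Auxiliary (`sl_le_one`). [folklore] -/
theorem sl_le_one (k : ℕ) : sl k ≤ 1 := by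
  unfold sl
  have : (1 / 2 : ℝ) ^ (k + 1) ≤ (1 / 2) ^ 1 := pow_le_pow_of_le_one (by norm_num) (by norm_num) (by omega)
  linarith

/-- Auxiliary (`sl_pos`). [folklore] -/
theorem sl_pos (k : ℕ) : 0 < sl k := by linarith [half_lt_sl k]

/-- Auxiliary (`sl_antitone`). [folklore] -/
theorem sl_antitone {k k' : ℕ} (h : k ≤ k') : sl k' ≤ sl k := by
  unfold sl
  have : (1 / 2 : ℝ) ^ (k' + 1) ≤ (1 / 2) ^ (k + 1) := pow_le_pow_of_le_one (by norm_num) (by norm_num) (by omega)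
  linarith

/-- Auxiliary (`smid_lt`). [folklore] -/
theorem smid_lt (k : ℕ) : smid k < sl k := by unfold smid; linarith [sl_succ_lt k]

/-- Auxiliary (`lt_smid`). [folklore] -/
theorem lt_smid (k : ℕ) : sl (k + 1) < smid k := by unfold smid; linarith [sl_succ_lt k]

/-- The core radius of a piece at parameter `s`: `ρ 0 + s (ρ 1 - ρ 0)`. [folklore] -/
def crad (pc : UPiece n M cD c₁ c₂) (s : ℝ) : ℝ := pc.ρ 0 + s * (pc.ρ 1 - pc.ρ 0)

/-- Auxiliary (`ρ0_lt_ρ1`). [folklore] -/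
theorem ρ0_lt_ρ1 (pc : UPiece n M cD c₁ c₂) : pc.ρ 0 < pc.ρ 1 := by
  have h := pc.hρ 0
  simp only [Fin.castSucc_zero, Fin.succ_zero_eq_one] at h
  linarith [pc.hη]

/-- Auxiliary (`crad_mono`). [folklore] -/
theorem crad_mono (pc : UPiece n M cD c₁ c₂) {s s' : ℝ} (h : s ≤ s') : crad pc s ≤ crad pc s' := by
  unfold crad
  have := ρ0_lt_ρ1 pc
  nlinarith

/-- Auxiliary (`crad_lt_crad`). [folklore] -/
theorem crad_lt_crad (pc : UPiece n M cD c₁ c₂) {s s' : ℝ} (h : s < s') : crad pc s < crad pc s' := by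
  unfold crad
  have := ρ0_lt_ρ1 pc
  nlinarith

/-- Auxiliary (`crad_le_ρ1`). [folklore] -/
theorem crad_le_ρ1 (pc : UPiece n M cD c₁ c₂) {s : ℝ} (h : s ≤ 1) : crad pc s ≤ pc.ρ 1 := by
  unfold crad; have := ρ0_lt_ρ1 pc; nlinarith

/-- Auxiliary (`ρ0_lt_crad`). [folklore] -/
theorem ρ0_lt_crad (pc : UPiece n M cD c₁ c₂) {s : ℝ} (h : 0 < s) : pc.ρ 0 < crad pc s := by
  unfold crad; have := ρ0_lt_ρ1 pc; nlinarith

/-- The open core of piece `j` at parameter `s` (empty for a no-op). [folklore] -/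
def core (j : ℕ) (s : ℝ) : Set M :=
  match Pc.P j with
  | none => ∅
  | some pc => pc.ψ.symm '' ball pc.z (crad pc s)

/-- The closed core of piece `j` at parameter `s` (empty for a no-op). [folklore] -/
def ccore (j : ℕ) (s : ℝ) : Set M :=
  match Pc.P j with
  | none => ∅
  | some pc => pc.ψ.symm '' closedBall pc.z (crad pc s)

/-- Auxiliary (`core_none`). [folklore] -/
theorem core_none {j : ℕ} (h : Pc.P j = none) (s : ℝ) : Pc.core j s = ∅ := by
  unfold core; rw [h]

/-- Auxiliary (`core_some`). [folklore] -/
theorem core_some {j : ℕ} {pc : UPiece n M cD c₁ c₂} (h : Pc.P j = some pc) (s : ℝ) :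
    Pc.core j s = pc.ψ.symm '' ball pc.z (crad pc s) := by
  unfold core; rw [h]

/-- Auxiliary (`ccore_none`). [folklore] -/
theorem ccore_none {j : ℕ} (h : Pc.P j = none) (s : ℝ) : Pc.ccore j s = ∅ := by
  unfold ccore; rw [h]

/-- Auxiliary (`ccore_some`). [folklore] -/
theorem ccore_some {j : ℕ} {pc : UPiece n M cD c₁ c₂} (h : Pc.P j = some pc) (s : ℝ) :
    Pc.ccore j s = pc.ψ.symm '' closedBall pc.z (crad pc s) := by
  unfold ccore; rw [h]

/-- Closed core balls of parameter `≤ 1` lie in the ball `B 1`. [folklore] -/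
theorem closedBall_crad_subset (pc : UPiece n M cD c₁ c₂) {s : ℝ} (hs : s ≤ 1) :
    closedBall pc.z (crad pc s) ⊆ pc.B 1 := closedBall_subset_closedBall (crad_le_ρ1 pc hs)

/-- Auxiliary (`isOpen_core`). [folklore] -/
theorem isOpen_core (j : ℕ) {s : ℝ} (hs : s ≤ 1) : IsOpen (Pc.core j s) := by
  rcases h : Pc.P j with _ | pc
  · rw [Pc.core_none h]; exact isOpen_empty
  · rw [Pc.core_some h]
    exact pc.ψ.symm.isOpen_image_of_subset_source isOpen_ball (by
      rw [pc.ψ.symm_source]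
      exact (ball_subset_closedBall.trans (closedBall_crad_subset pc hs)).trans (pc.B_subset_target 1))

/-- Auxiliary (`isCompact_ccore`). [folklore] -/
theorem isCompact_ccore (j : ℕ) {s : ℝ} (hs : s ≤ 1) : IsCompact (Pc.ccore j s) := by
  rcases h : Pc.P j with _ | pc
  · rw [Pc.ccore_none h]; exact isCompact_empty
  · rw [Pc.ccore_some h]
    exact (isCompact_closedBall _ _).image_of_continuousOn (pc.ψ.continuousOn_symm.mono
      ((closedBall_crad_subset pc hs).trans (pc.B_subset_target 1)))

/-- Auxiliary (`core_subset_ccore`). [folklore] -/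
theorem core_subset_ccore (j : ℕ) (s : ℝ) : Pc.core j s ⊆ Pc.ccore j s := by
  rcases h : Pc.P j with _ | pc
  · rw [Pc.core_none h]; exact empty_subset _
  · rw [Pc.core_some h, Pc.ccore_some h]; exact image_mono ball_subset_closedBall

/-- Auxiliary (`ccore_subset_core`). [folklore] -/
theorem ccore_subset_core (j : ℕ) {s s' : ℝ} (h : s < s') : Pc.ccore j s ⊆ Pc.core j s' := by
  rcases hP : Pc.P j with _ | pc
  · rw [Pc.ccore_none hP]; exact empty_subset _
  · rw [Pc.core_some hP, Pc.ccore_some hP]; exact image_mono (closedBall_subset_ball (crad_lt_crad pc h))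

/-- Auxiliary (`core_mono`). [folklore] -/
theorem core_mono (j : ℕ) {s s' : ℝ} (h : s ≤ s') : Pc.core j s ⊆ Pc.core j s' := by
  rcases hP : Pc.P j with _ | pc
  · rw [Pc.core_none hP]; exact empty_subset _
  · rw [Pc.core_some hP, Pc.core_some hP]; exact image_mono (ball_subset_ball (crad_mono pc h))

/-- The core of a piece contains its innermost ball `MB 0`. [folklore] -/
theorem MB_subset_core {j : ℕ} {pc : UPiece n M cD c₁ c₂} (h : Pc.P j = some pc) {s : ℝ} (hs : 0 < s) :
    pc.MB 0 ⊆ Pc.core j s := by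
  rw [Pc.core_some h]; exact image_mono (closedBall_subset_ball (ρ0_lt_crad pc hs))

/-- Cores of parameter `≤ 1` lie in the new ball region `ψ.symm '' ball z (ρ 1)`. [folklore] -/
theorem core_subset_ball {j : ℕ} {pc : UPiece n M cD c₁ c₂} (h : Pc.P j = some pc) {s : ℝ} (hs : s ≤ 1) :
    Pc.core j s ⊆ pc.ψ.symm '' ball pc.z (pc.ρ 1) := by
  rw [Pc.core_some h]; exact image_mono (ball_subset_ball (crad_le_ρ1 pc hs))

/-- Closed cores of parameter `≤ 1` lie in `MB 1`. [folklore] -/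
theorem ccore_subset_MB {j : ℕ} {pc : UPiece n M cD c₁ c₂} (h : Pc.P j = some pc) {s : ℝ} (hs : s ≤ 1) :
    Pc.ccore j s ⊆ pc.MB 1 := by
  rw [Pc.ccore_some h]; exact image_mono (closedBall_crad_subset pc hs)

/-- **The PL region** at time `k` and parameter `s`: the union of the cores of the first `k`
pieces. [folklore] -/
def A (k : ℕ) (s : ℝ) : Set M := ⋃ j ∈ Finset.range k, Pc.core j s

/-- **The closed PL region** at time `k`: the union of the closed cores at the intermediate
parameter. [folklore] -/
def Acl (k : ℕ) : Set M := ⋃ j ∈ Finset.range k, Pc.ccore j (smid k)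

/-- Auxiliary (`isOpen_A`). [folklore] -/
theorem isOpen_A (k : ℕ) {s : ℝ} (hs : s ≤ 1) : IsOpen (Pc.A k s) :=
  isOpen_biUnion fun j _ => Pc.isOpen_core j hs

/-- Auxiliary (`isCompact_Acl`). [folklore] -/
theorem isCompact_Acl (k : ℕ) : IsCompact (Pc.Acl k) :=
  (Finset.range k).isCompact_biUnion fun j _ => Pc.isCompact_ccore j ((smid_lt k).le.trans (sl_le_one k))

/-- Auxiliary (`mem_A_iff`). [folklore] -/
theorem mem_A_iff {k : ℕ} {s : ℝ} {q : M} : q ∈ Pc.A k s ↔ ∃ j < k, q ∈ Pc.core j s := by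
  simp [A]

/-- Auxiliary (`mem_Acl_iff`). [folklore] -/
theorem mem_Acl_iff {k : ℕ} {q : M} : q ∈ Pc.Acl k ↔ ∃ j < k, q ∈ Pc.ccore j (smid k) := by
  simp [Acl]

/-- Auxiliary (`A_mono_s`). [folklore] -/
theorem A_mono_s (k : ℕ) {s s' : ℝ} (h : s ≤ s') : Pc.A k s ⊆ Pc.A k s' := fun q hq => by
  obtain ⟨j, hj, hq⟩ := Pc.mem_A_iff.1 hq
  exact Pc.mem_A_iff.2 ⟨j, hj, Pc.core_mono j h hq⟩

/-- Auxiliary (`A_succ`). [folklore] -/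
theorem A_succ (k : ℕ) (s : ℝ) : Pc.A (k + 1) s = Pc.A k s ∪ Pc.core k s := by
  ext q
  simp only [Pc.mem_A_iff, mem_union]
  constructor
  · rintro ⟨j, hj, hq⟩
    rcases Nat.lt_succ_iff_lt_or_eq.1 hj with h | rfl
    · exact Or.inl ⟨j, h, hq⟩
    · exact Or.inr hq
  · rintro (⟨j, hj, hq⟩ | hq)
    · exact ⟨j, Nat.lt_succ_of_lt hj, hq⟩
    · exact ⟨k, Nat.lt_succ_self k, hq⟩

/-- Auxiliary (`A_subset_Acl`). [folklore] -/
theorem A_subset_Acl (k : ℕ) : Pc.A k (sl (k + 1)) ⊆ Pc.Acl k := fun q hq => by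
  obtain ⟨j, hj, hq⟩ := Pc.mem_A_iff.1 hq
  exact Pc.mem_Acl_iff.2 ⟨j, hj, Pc.core_subset_ccore j _ (Pc.core_mono j (lt_smid k).le hq)⟩

/-- Auxiliary (`Acl_subset_A`). [folklore] -/
theorem Acl_subset_A (k : ℕ) : Pc.Acl k ⊆ Pc.A k (sl k) := fun q hq => by
  obtain ⟨j, hj, hq⟩ := Pc.mem_Acl_iff.1 hq
  exact Pc.mem_A_iff.2 ⟨j, hj, Pc.ccore_subset_core j (smid_lt k) hq⟩

end Levels

section Margins

variable {n : ℕ} {M : Type*} [TopologicalSpace M] [TopologicalSpace.MetrizableSpace M]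
  {cD c₁ c₂ : ChartedSpace (𝔼 n) M} (Pc : UPieces n M cD c₁ c₂)

/-- **The chart margin of stage `k`**: points of the piece within chart distance `γ` of the PL
region `A k (s (k+1))` lie in the closed region `Acl k` (finitely many compactness arguments,
through the metric of `M`). [folklore] -/
theorem exists_gamma (k : ℕ) (pc : UPiece n M cD c₁ c₂) :
    ∃ γ > 0, ∀ q ∈ pc.ψ.source, ∀ q' ∈ pc.ψ.source, pc.ψ q ∈ pc.B 9 → ‖pc.ψ q' - pc.ψ q‖ ≤ γ →
      q' ∈ Pc.A k (sl (k + 1)) → q ∈ Pc.Acl k := by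
  letI : MetricSpace M := TopologicalSpace.metrizableSpaceMetric M
  -- metric margins of the cores
  have hν : ∃ ν > 0, ∀ j ∈ (Finset.range k : Set ℕ), ∀ x ∈ Pc.ccore j (sl (k + 1)), ∀ y : M,
      dist x y ≤ ν → y ∈ Pc.core j (smid k) := by
    refine exists_pos_forall_of_finite (Finset.range k).finite_toSet
      (P := fun j ν => ∀ x ∈ Pc.ccore j (sl (k + 1)), ∀ y : M, dist x y ≤ ν → y ∈ Pc.core j (smid k))
      (fun j _ r r' _ hle h x hx y hxy => h x hx y (hxy.trans hle)) fun j _ => ?_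
    obtain ⟨ν, hν, hsub⟩ := (Pc.isCompact_ccore j (sl_le_one (k + 1))).exists_cthickening_subset_open
      (Pc.isOpen_core j ((smid_lt k).le.trans (sl_le_one k))) (Pc.ccore_subset_core j (lt_smid k))
    exact ⟨ν, hν, fun x hx y hxy => hsub (mem_cthickening_of_dist_le y x ν _ hx (by rw [dist_comm]; exact hxy))⟩
  obtain ⟨ν, hν0, hν⟩ := hν
  -- a compact chart neighbourhood of `B 9` inside the target
  obtain ⟨τ, hτ, hτsub⟩ := (pc.isCompact_B 9).exists_cthickening_subset_open pc.ψ.open_target (pc.B_subset_target 9)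
  have hB9c : IsCompact (cthickening τ (pc.B 9)) := (pc.isCompact_B 9).cthickening
  -- uniform continuity of `ψ.symm` there
  have huc := hB9c.uniformContinuousOn_of_continuous (pc.ψ.continuousOn_symm.mono hτsub)
  obtain ⟨γ₂, hγ₂, hcont⟩ := Metric.uniformContinuousOn_iff.1 huc ν hν0
  refine ⟨min τ γ₂ / 2, by positivity, fun q hq q' hq' hqB hle hq'A => ?_⟩
  have hτ' : min τ γ₂ / 2 ≤ τ := by linarith [min_le_left τ γ₂, le_min hτ.le hγ₂.le]
  have hw : pc.ψ q ∈ cthickening τ (pc.B 9) := self_subset_cthickening _ hqB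
  have hw' : pc.ψ q' ∈ cthickening τ (pc.B 9) :=
    mem_cthickening_of_dist_le _ _ _ _ hqB (by rw [dist_eq_norm]; exact hle.trans hτ')
  have hdist : dist q' q < ν := by
    have h := hcont (pc.ψ q') hw' (pc.ψ q) hw (by
      rw [dist_eq_norm]; linarith [min_le_right τ γ₂, le_min hτ.le hγ₂.le])
    rwa [pc.ψ.left_inv hq', pc.ψ.left_inv hq] at h
  obtain ⟨j, hj, hq'j⟩ := Pc.mem_A_iff.1 hq'A
  refine Pc.mem_Acl_iff.2 ⟨j, hj, Pc.core_subset_ccore j _ ?_⟩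
  exact hν j (Finset.mem_coe.2 (Finset.mem_range.2 hj)) q' (Pc.core_subset_ccore j _ hq'j) q hdist.le

end Margins

/-! ### Orbits of the induction -/

section Orbits

variable {n : ℕ} {M : Type*} [TopologicalSpace M] [TopologicalSpace.MetrizableSpace M]
  {cD c₁ c₂ : ChartedSpace (𝔼 n) M} (Pc : UPieces n M cD c₁ c₂)

-- `[MetrizableSpace M]` is a section variable used by most lemmas below; per-lemma `omit` would be noise.
set_option linter.unusedSectionVars false

/-- **The properties of the comparison homeomorphism of stage `t`** used by the limiting argument:
trivial for a no-op; support in `MB 5 → MB 6`; displacement `≤ lam t` in the metric of `M`;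
the balls `MB ℓ`, `ℓ ≥ 6`, preserved. (A `Prop`-valued bookkeeping structure.) [folklore] -/
structure StepProps (t : ℕ) (Φ : M ≃ₜ M) : Prop where
  none : Pc.P t = none → Φ = Homeomorph.refl M
  supp : ∀ pc, Pc.P t = some pc → ∀ x, Φ x ≠ x → x ∈ pc.MB 5 ∧ Φ x ∈ pc.MB 6
  disp : ∀ x, (letI := TopologicalSpace.metrizableSpaceMetric M; dist (Φ x) x ≤ Pc.lam t)
  img : ∀ pc, Pc.P t = some pc → ∀ ℓ : Fin 10, 6 ≤ ℓ → Φ '' pc.MB ℓ = pc.MB ℓ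

/-- The identity has the step properties of a no-op stage. [folklore] -/
theorem stepProps_refl {t : ℕ} (ht : Pc.P t = none) : Pc.StepProps t (Homeomorph.refl M) where
  none := fun _ => rfl
  supp := fun pc h => by rw [ht] at h; cases h
  disp := fun x => by
    letI := TopologicalSpace.metrizableSpaceMetric M
    show dist x x ≤ _
    rw [dist_self]; exact Pc.lam_nonneg t
  img := fun pc h => by rw [ht] at h; cases h

/-- The composition `Φ (k-1) ∘ ⋯ ∘ Φ 0` of the first `k` maps. [folklore] -/
def compH (Φ : ℕ → M ≃ₜ M) : ℕ → M ≃ₜ M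
  | 0 => Homeomorph.refl M
  | k + 1 => (compH Φ k).trans (Φ k)

/-- Auxiliary (`compH_zero`). [folklore] -/
@[simp] theorem compH_zero (Φ : ℕ → M ≃ₜ M) : compH Φ 0 = Homeomorph.refl M := rfl

/-- Auxiliary (`compH_succ`). [folklore] -/
theorem compH_succ (Φ : ℕ → M ≃ₜ M) (k : ℕ) : compH Φ (k + 1) = (compH Φ k).trans (Φ k) := rfl

/-- `compH Φ k x` is the orbit of `x`. [folklore] -/
theorem compH_apply (Φ : ℕ → M ≃ₜ M) (k : ℕ) (x : M) : compH Φ k x = orbit (fun t => ⇑(Φ t)) x k := by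
  induction k with
  | zero => rfl
  | succ k ih => rw [compH_succ, Homeomorph.trans_apply, ih, orbit_succ]

/-- The support sets of the stages: `MB 9` of the piece (empty for a no-op). [folklore] -/
def Ssupp (t : ℕ) : Set M := match Pc.P t with | none => ∅ | some pc => pc.MB 9

/-- Auxiliary (`Ssupp_some`). [folklore] -/
theorem Ssupp_some {t : ℕ} {pc : UPiece n M cD c₁ c₂} (h : Pc.P t = some pc) : Pc.Ssupp t = pc.MB 9 := by
  unfold Ssupp; rw [h]

/-- Auxiliary (`Ssupp_subset`). [folklore] -/
theorem Ssupp_subset (t : ℕ) : Pc.Ssupp t ⊆ Pc.K (Pc.lev t + 1) := by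
  rcases h : Pc.P t with _ | pc
  · unfold Ssupp; rw [h]; exact empty_subset _
  · rw [Pc.Ssupp_some h]; exact (Pc.hwin₁ t pc h).trans interior_subset

/-- Auxiliary (`Ssupp_disjoint`). [folklore] -/
theorem Ssupp_disjoint (t i : ℕ) (hi : i + 2 ≤ Pc.lev t) : Disjoint (Pc.Ssupp t) (Pc.K i) := by
  rcases h : Pc.P t with _ | pc
  · unfold Ssupp; rw [h]; exact Set.disjoint_left.2 fun x hx => hx.elim
  · rw [Pc.Ssupp_some h]; exact Pc.hwin₂ t pc h i hi

/-- The metric gaps in the form used by the orbit lemma. [folklore] -/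
theorem gap_le_dist (i : ℕ) : ∀ x ∈ Pc.K i, ∀ y : M, y ∉ Pc.K (i + 1) →
    (letI := TopologicalSpace.metrizableSpaceMetric M; Pc.gap i ≤ dist x y) := by
  letI := TopologicalSpace.metrizableSpaceMetric M
  intro x hx y hy
  by_contra hlt
  push Not at hlt
  exact hy (Pc.gap_spec i x hx y hlt.le)

/-- Steps with the step properties are supported in `Ssupp`. [folklore] -/
theorem supp_of_stepProps {t : ℕ} {Φ : M ≃ₜ M} (h : Pc.StepProps t Φ) (x : M) (hx : Φ x ≠ x) :
    x ∈ Pc.Ssupp t ∧ Φ x ∈ Pc.Ssupp t := by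
  rcases hP : Pc.P t with _ | pc
  · exact absurd (by rw [h.none hP]; rfl) hx
  · obtain ⟨h5, h6⟩ := h.supp pc hP x hx
    rw [Pc.Ssupp_some hP]
    exact ⟨pc.MB_mono (by decide) h5, pc.MB_mono (by decide) h6⟩

/-- The same for the inverses (the step properties are symmetric in this respect). [folklore] -/
theorem supp_symm_of_stepProps {t : ℕ} {Φ : M ≃ₜ M} (h : Pc.StepProps t Φ) (x : M) (hx : Φ.symm x ≠ x) :
    x ∈ Pc.Ssupp t ∧ Φ.symm x ∈ Pc.Ssupp t := by
  have hx' : Φ (Φ.symm x) ≠ Φ.symm x := by rw [Homeomorph.apply_symm_apply]; exact fun h' => hx h'.symm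
  obtain ⟨h1, h2⟩ := Pc.supp_of_stepProps h _ hx'
  rw [Homeomorph.apply_symm_apply] at h2
  exact ⟨h2, h1⟩

/-- Displacement of the inverses. [folklore] -/
theorem disp_symm_of_stepProps {t : ℕ} {Φ : M ≃ₜ M} (h : Pc.StepProps t Φ) (x : M) :
    (letI := TopologicalSpace.metrizableSpaceMetric M; dist (Φ.symm x) x ≤ Pc.lam t) := by
  letI := TopologicalSpace.metrizableSpaceMetric M
  have := h.disp (Φ.symm x)
  rwa [Homeomorph.apply_symm_apply, dist_comm] at this

/-- **Forward confinement**: compositions of steps map `K i` into `K (i+1)`. [cite: Munkres1966, Thm 10.4] -/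
theorem compH_mem {Φ : ℕ → M ≃ₜ M} (hΦ : ∀ t, Pc.StepProps t (Φ t)) (k i : ℕ) {x : M} (hx : x ∈ Pc.K i) :
    compH Φ k x ∈ Pc.K (i + 1) := by
  letI := TopologicalSpace.metrizableSpaceMetric M
  rw [compH_apply]
  exact orbit_mem_succ (fun i => Pc.K i) (fun a b h => Pc.K.subset h) Pc.gap (Pc.gap_le_dist)
    (fun t => ⇑(Φ t)) Pc.Ssupp Pc.lev Pc.lam Pc.lam_nonneg (fun t x hx => Pc.supp_of_stepProps (hΦ t) x hx)
    (fun t x => (hΦ t).disp x) Pc.Ssupp_subset Pc.Ssupp_disjoint Pc.sum_lam_lt_gap i hx k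

/-- The reversed sequence of inverses of the first `k` steps. [folklore] -/
def revInv (Φ : ℕ → M ≃ₜ M) (k : ℕ) (t : ℕ) : M → M := if t < k then ⇑(Φ (k - 1 - t)).symm else id

/-- Orbit shift: dropping the first map. [folklore] -/
theorem orbit_shift {X : Type*} (Ψ : ℕ → X → X) (y : X) (T : ℕ) :
    orbit Ψ y (T + 1) = orbit (fun t => Ψ (t + 1)) (Ψ 0 y) T := by
  induction T with
  | zero => rfl
  | succ T ih => rw [orbit_succ, ih, orbit_succ]

/-- **The inverse of the composition is the orbit under the reversed inverses.** [folklore] -/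
theorem compH_symm_apply (Φ : ℕ → M ≃ₜ M) (k : ℕ) (y : M) : (compH Φ k).symm y = orbit (revInv Φ k) y k := by
  induction k generalizing y with
  | zero => rfl
  | succ k ih =>
    rw [compH_succ, Homeomorph.symm_trans_apply, ih, orbit_shift]
    have h0 : revInv Φ (k + 1) 0 = ⇑(Φ k).symm := by
      unfold revInv; rw [if_pos (Nat.succ_pos k)]; simp
    have h1 : (fun t => revInv Φ (k + 1) (t + 1)) = revInv Φ k := by
      funext t
      unfold revInv
      by_cases ht : t < k
      · rw [if_pos (Nat.succ_lt_succ ht), if_pos ht]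
        have : k + 1 - 1 - (t + 1) = k - 1 - t := by omega
        rw [this]
      · rw [if_neg (fun h => ht (Nat.lt_of_succ_lt_succ h)), if_neg ht]
    rw [h0, h1]

/-- Levels of the reversed sequence. [folklore] -/
def revLev (k : ℕ) (t : ℕ) : ℕ := if t < k then Pc.lev (k - 1 - t) else 0

/-- Displacement bounds of the reversed sequence. [folklore] -/
def revLam (k : ℕ) (t : ℕ) : ℝ := if t < k then Pc.lam (k - 1 - t) else 0

/-- Supports of the reversed sequence. [folklore] -/
def revS (k : ℕ) (t : ℕ) : Set M := if t < k then Pc.Ssupp (k - 1 - t) else ∅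

/-- **Band sums of the reversed sequence** are band sums of the original one. [folklore] -/
theorem sum_revLam_le {k : ℕ} (s : Finset ℕ) {p : ℕ → Prop}
    (hs : ∀ t ∈ s, p (Pc.revLev k t)) {B : ℝ}
    (hB : ∀ s' : Finset ℕ, (∀ u ∈ s', p (Pc.lev u)) → ∑ u ∈ s', Pc.lam u ≤ B) :
    ∑ t ∈ s, Pc.revLam k t ≤ B := by
  classical
  -- split off the times `≥ k` (zero displacement)
  have hsplit : ∑ t ∈ s, Pc.revLam k t = ∑ t ∈ s.filter (· < k), Pc.lam (k - 1 - t) := by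
    rw [Finset.sum_filter]
    refine Finset.sum_congr rfl fun t _ => ?_
    unfold revLam
    split_ifs <;> rfl
  rw [hsplit]
  -- reindex by `u = k - 1 - t`
  have hinj : Set.InjOn (fun t => k - 1 - t) ↑(s.filter (· < k)) := by
    intro t ht t' ht' h
    have h1 := (Finset.mem_filter.1 (Finset.mem_coe.1 ht)).2
    have h2 := (Finset.mem_filter.1 (Finset.mem_coe.1 ht')).2
    simp only at h
    omega
  rw [← Finset.sum_image hinj]
  refine hB _ fun u hu => ?_
  obtain ⟨t, ht, rfl⟩ := Finset.mem_image.1 hu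
  obtain ⟨hts, htk⟩ := Finset.mem_filter.1 ht
  have := hs t hts
  unfold revLev at this
  rwa [if_pos htk] at this

/-- Auxiliary (`revLam_nonneg`). [folklore] -/
theorem revLam_nonneg (k t : ℕ) : 0 ≤ Pc.revLam k t := by
  unfold revLam; split_ifs
  · exact Pc.lam_nonneg _
  · exact le_rfl

/-- Auxiliary (`rev_supp`). [folklore] -/
theorem rev_supp {Φ : ℕ → M ≃ₜ M} (hΦ : ∀ t, Pc.StepProps t (Φ t)) (k t : ℕ) (x : M)
    (hx : revInv Φ k t x ≠ x) : x ∈ Pc.revS k t ∧ revInv Φ k t x ∈ Pc.revS k t := by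
  unfold revInv at hx ⊢; unfold revS
  split_ifs at hx ⊢ with h
  · exact Pc.supp_symm_of_stepProps (hΦ _) x hx
  · exact absurd rfl hx

/-- Auxiliary (`rev_disp`). [folklore] -/
theorem rev_disp {Φ : ℕ → M ≃ₜ M} (hΦ : ∀ t, Pc.StepProps t (Φ t)) (k t : ℕ) (x : M) :
    (letI := TopologicalSpace.metrizableSpaceMetric M; dist (revInv Φ k t x) x ≤ Pc.revLam k t) := by
  letI := TopologicalSpace.metrizableSpaceMetric M
  unfold revInv revLam
  split_ifs with h
  · exact Pc.disp_symm_of_stepProps (hΦ _) x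
  · simp

/-- Auxiliary (`revS_subset`). [folklore] -/
theorem revS_subset (k t : ℕ) : Pc.revS k t ⊆ Pc.K (Pc.revLev k t + 1) := by
  unfold revS revLev
  split_ifs with h
  · exact Pc.Ssupp_subset _
  · exact empty_subset _

/-- Auxiliary (`revS_disjoint`). [folklore] -/
theorem revS_disjoint (k t i : ℕ) (hi : i + 2 ≤ Pc.revLev k t) : Disjoint (Pc.revS k t) (Pc.K i) := by
  unfold revS; unfold revLev at hi
  split_ifs at hi ⊢ with h
  · exact Pc.Ssupp_disjoint _ i hi
  · exact Set.disjoint_left.2 fun x hx => hx.elim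

/-- Auxiliary (`rev_sum`). [folklore] -/
theorem rev_sum (k i : ℕ) (s : Finset ℕ) (hs : ∀ t ∈ s, i ≤ Pc.revLev k t ∧ Pc.revLev k t ≤ i + 2) :
    ∑ t ∈ s, Pc.revLam k t < Pc.gap i := by
  have := Pc.sum_revLam_le s (p := fun l => i ≤ l ∧ l ≤ i + 2) hs (B := Pc.gap i / 2)
    fun s' hs' => Pc.sum_lam_le_half_gap i s' hs'
  linarith [Pc.gap_pos i]

/-- **Backward orbits of points of `K i` stay in `K (i+1)`.** [cite: Munkres1966, Thm 10.4] -/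
theorem rev_orbit_mem {Φ : ℕ → M ≃ₜ M} (hΦ : ∀ t, Pc.StepProps t (Φ t)) (k i : ℕ) {y : M} (hy : y ∈ Pc.K i)
    (T : ℕ) : orbit (revInv Φ k) y T ∈ Pc.K (i + 1) := by
  letI := TopologicalSpace.metrizableSpaceMetric M
  exact orbit_mem_succ (fun i => Pc.K i) (fun a b h => Pc.K.subset h) Pc.gap (Pc.gap_le_dist)
    (revInv Φ k) (Pc.revS k) (Pc.revLev k) (Pc.revLam k) (Pc.revLam_nonneg k) (Pc.rev_supp hΦ k)
    (Pc.rev_disp hΦ k) (Pc.revS_subset k) (Pc.revS_disjoint k) (Pc.rev_sum k) i hy T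

/-- **Backward orbits of points outside `K (i+1)` stay outside `K i`.** [cite: Munkres1966, Thm 10.4] -/
theorem rev_orbit_notMem {Φ : ℕ → M ≃ₜ M} (hΦ : ∀ t, Pc.StepProps t (Φ t)) (k i : ℕ) {y : M}
    (hy : y ∉ Pc.K (i + 1)) (T : ℕ) : orbit (revInv Φ k) y T ∉ Pc.K i := by
  letI := TopologicalSpace.metrizableSpaceMetric M
  exact orbit_notMem (fun i => Pc.K i) (fun a b h => Pc.K.subset h) Pc.gap (Pc.gap_le_dist)
    (revInv Φ k) (Pc.revS k) (Pc.revLev k) (Pc.revLam k) (Pc.revLam_nonneg k) (Pc.rev_supp hΦ k)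
    (Pc.rev_disp hΦ k) (Pc.revS_subset k) (Pc.revS_disjoint k) (Pc.rev_sum k) i hy T

/-- **Backward confinement**: inverses of compositions of steps map `K i` into `K (i+1)`.
[cite: Munkres1966, Thm 10.4] -/
theorem compH_symm_mem {Φ : ℕ → M ≃ₜ M} (hΦ : ∀ t, Pc.StepProps t (Φ t)) (k i : ℕ) {y : M} (hy : y ∈ Pc.K i) :
    (compH Φ k).symm y ∈ Pc.K (i + 1) := by
  rw [compH_symm_apply]; exact Pc.rev_orbit_mem hΦ k i hy k

/-- **The drift bound**: the inverse of the composition of the first `k` steps moves points of the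
top ball of piece `k` by at most half its chart margin (only steps of levels within `3` of `lev k`
can act on the backward orbit, `sum_lam_le_cmar`). [cite: Munkres1966, Thm 10.4] -/
theorem dist_compH_symm_le {Φ : ℕ → M ≃ₜ M} (hΦ : ∀ t, Pc.StepProps t (Φ t)) (k : ℕ)
    {pc : UPiece n M cD c₁ c₂} (hk : Pc.P k = some pc) {y : M} (hy : y ∈ pc.MB 9) :
    (letI := TopologicalSpace.metrizableSpaceMetric M; dist ((compH Φ k).symm y) y ≤ Pc.cmar k / 2) := by
  classical
  letI := TopologicalSpace.metrizableSpaceMetric M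
  rw [compH_symm_apply]
  refine (dist_orbit_le (revInv Φ k) (Pc.revLam k) (Pc.rev_disp hΦ k) y k).trans ?_
  have hyK : y ∈ Pc.K (Pc.lev k + 1) := by
    have := Pc.Ssupp_subset k; rw [Pc.Ssupp_some hk] at this; exact this hy
  refine Pc.sum_revLam_le _ (p := fun l => Pc.lev k ≤ l + 3 ∧ l ≤ Pc.lev k + 3) (fun t ht => ?_)
    (B := Pc.cmar k / 2) fun s' hs' => Pc.sum_lam_le_cmar (by rw [hk]; rfl) s' hs'
  obtain ⟨htk, hmove⟩ := Finset.mem_filter.1 ht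
  have htk' : t < k := Finset.mem_range.1 htk
  -- the moving step `s = k - 1 - t` and the orbit point `z`
  set z := orbit (revInv Φ k) y t with hz
  obtain ⟨hzS, -⟩ := Pc.rev_supp hΦ k t z hmove
  unfold revS at hzS; rw [if_pos htk'] at hzS
  unfold revLev; rw [if_pos htk']
  set sidx := k - 1 - t with hsidx
  rcases hP : Pc.P sidx with _ | pcs
  · unfold Ssupp at hzS; rw [hP] at hzS; exact hzS.elim
  · rw [Pc.Ssupp_some hP] at hzS
    constructor
    · -- lower bound on the level of the moving step
      by_cases h3 : Pc.lev k ≤ 3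
      · omega
      · push Not at h3
        have hy' : y ∉ Pc.K (Pc.lev k - 3 + 1) := by
          have hdis := Pc.hwin₂ k pc hk (Pc.lev k - 2) (by omega)
          have : Pc.lev k - 3 + 1 = Pc.lev k - 2 := by omega
          rw [this]
          exact Set.disjoint_left.1 hdis hy
        have hz' : z ∉ Pc.K (Pc.lev k - 3) := Pc.rev_orbit_notMem hΦ k _ hy' t
        have hz'' : z ∈ Pc.K (Pc.lev sidx + 1) := (Pc.hwin₁ sidx pcs hP).trans interior_subset hzS
        by_contra hlt
        push Not at hlt
        exact hz' (Pc.K.subset (by omega) hz'')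
    · -- upper bound
      have hz' : z ∈ Pc.K (Pc.lev k + 2) := Pc.rev_orbit_mem hΦ k _ hyK t
      by_contra hlt
      push Not at hlt
      exact Set.disjoint_left.1 (Pc.hwin₂ sidx pcs hP (Pc.lev k + 2) (by omega)) hzS hz'

/-- **The drift hypothesis**: the inverse of the composition maps the top ball of piece `k` into
both PL chart sources. [cite: Munkres1966, Thm 10.4] -/
theorem compH_symm_mem_source {Φ : ℕ → M ≃ₜ M} (hΦ : ∀ t, Pc.StepProps t (Φ t)) (k : ℕ)
    {pc : UPiece n M cD c₁ c₂} (hk : Pc.P k = some pc) {y : M} (hy : y ∈ pc.MB 9) :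
    (compH Φ k).symm y ∈ pc.e₁.source ∩ pc.e₂.source := by
  letI := TopologicalSpace.metrizableSpaceMetric M
  refine Pc.cmar_spec k pc hk y hy _ ?_
  have := Pc.dist_compH_symm_le hΦ k hk hy
  rw [dist_comm] at this
  linarith [Pc.cmar_pos k]

/-- The identity has the step properties for every stage index (support and image conditions are
vacuous or trivial). [folklore] -/
theorem stepProps_refl_any (t : ℕ) : Pc.StepProps t (Homeomorph.refl M) where
  none := fun _ => rfl
  supp := fun pc _ x hx => absurd rfl hx
  disp := fun x => by
    letI := TopologicalSpace.metrizableSpaceMetric M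
    show dist x x ≤ _
    rw [dist_self]; exact Pc.lam_nonneg t
  img := fun pc _ ℓ _ => by simp

end Orbits

/-! ### The induction -/

section Induction

variable {n : ℕ} {M : Type*} [TopologicalSpace M] [T2Space M] [TopologicalSpace.MetrizableSpace M]
  {cD c₁ c₂ : ChartedSpace (𝔼 n) M} (hcomp : IsPLOn.comp (n := n)) (haff : isPLOn_affineMap (n := n) (m := n))
  (Pc : UPieces n M cD c₁ c₂)

-- `[T2Space M]`, `[MetrizableSpace M]` are section variables used throughout; per-lemma `omit` would be noise.
set_option linter.unusedSectionVars false

/-- **The invariant of the induction at time `k`** for the pair `(F, G)`: both PD along their PL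
structure, `F⁻¹ ∘ G` PL in both directions over the PL region `A k (s k)`, and both compositions
of steps with the step properties. (A `Prop`-valued bookkeeping structure.) [cite: Munkres1966, Thm 10.5] -/
structure IterInv (k : ℕ) (F G : M ≃ₜ M) : Prop where
  pdF : PDAlong n c₁ cD F
  pdG : PDAlong n c₂ cD G
  pl : PLAlongOn n c₂ c₁ (G.trans F.symm) (G ⁻¹' Pc.A k (sl k))
  pl' : PLAlongOn n c₁ c₂ (F.trans G.symm) (F ⁻¹' Pc.A k (sl k))
  orbF : ∃ Φ : ℕ → M ≃ₜ M, (∀ t, k ≤ t → Φ t = Homeomorph.refl M) ∧ F = compH Φ k ∧ ∀ t, Pc.StepProps t (Φ t)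
  orbG : ∃ Φ : ℕ → M ≃ₜ M, (∀ t, k ≤ t → Φ t = Homeomorph.refl M) ∧ G = compH Φ k ∧ ∀ t, Pc.StepProps t (Φ t)

/-- **The invariant at time `0`** for `(id, id)`: Whitehead compatibility of the two PL structures.
[cite: Munkres1966, Thm 10.5] -/
theorem iterInv_zero (hc₁ : IsWhiteheadCompatible n M c₁ cD) (hc₂ : IsWhiteheadCompatible n M c₂ cD) :
    Pc.IterInv 0 (Homeomorph.refl M) (Homeomorph.refl M) where
  pdF := pdAlong_refl_iff.2 hc₁
  pdG := pdAlong_refl_iff.2 hc₂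
  pl := by
    have : (Homeomorph.refl M) ⁻¹' Pc.A 0 (sl 0) = ∅ := by ext q; simp [UPieces.A]
    rw [this]; exact plAlongOn_empty
  pl' := by
    have : (Homeomorph.refl M) ⁻¹' Pc.A 0 (sl 0) = ∅ := by ext q; simp [UPieces.A]
    rw [this]; exact plAlongOn_empty
  orbF := ⟨fun _ => Homeomorph.refl M, fun _ _ => rfl, rfl, Pc.stepProps_refl_any⟩
  orbG := ⟨fun _ => Homeomorph.refl M, fun _ _ => rfl, rfl, Pc.stepProps_refl_any⟩

/-- The drift hypothesis from the invariant. [folklore] -/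
theorem drift_of_orb {k : ℕ} {F : M ≃ₜ M}
    (h : ∃ Φ : ℕ → M ≃ₜ M, (∀ t, k ≤ t → Φ t = Homeomorph.refl M) ∧ F = compH Φ k ∧ ∀ t, Pc.StepProps t (Φ t))
    {pc : UPiece n M cD c₁ c₂} (hk : Pc.P k = some pc) :
    pc.ψ.symm '' pc.B 9 ⊆ F '' pc.e₁.source ∧ pc.ψ.symm '' pc.B 9 ⊆ F '' pc.e₂.source := by
  obtain ⟨Φ, -, rfl, hΦ⟩ := h
  constructor
  · intro y hy
    exact ⟨(compH Φ k).symm y, (Pc.compH_symm_mem_source hΦ k hk hy).1, Homeomorph.apply_symm_apply _ _⟩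
  · intro y hy
    exact ⟨(compH Φ k).symm y, (Pc.compH_symm_mem_source hΦ k hk hy).2, Homeomorph.apply_symm_apply _ _⟩

variable (hn : 0 < n)

/-- **The stage input at time `k`** from the invariant, when stage `k` is a genuine piece.
[cite: Munkres1966, Thm 10.5] -/
def stageIn (k : ℕ) (F G : M ≃ₜ M) (inv : Pc.IterInv k F G) (pc : UPiece n M cD c₁ c₂) (hk : Pc.P k = some pc) :
    UStageIn n M cD c₁ c₂ where
  hn := hn
  P := pc
  F := F
  G := G
  hF := inv.pdF
  hG := inv.pdG
  A := Pc.A k (sl k)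
  hA := Pc.isOpen_A k (sl_le_one k)
  hPL := inv.pl
  hPL' := inv.pl'
  Acl := Pc.Acl k
  hAcl := (Pc.isCompact_Acl k).isClosed
  hAclA := Pc.Acl_subset_A k
  Am := Pc.A k (sl (k + 1))
  hAm := Pc.isOpen_A k (sl_le_one (k + 1))
  hAmAcl := Pc.A_subset_Acl k
  γ := (Pc.exists_gamma k pc).choose
  hγ := (Pc.exists_gamma k pc).choose_spec.1
  hmargin := (Pc.exists_gamma k pc).choose_spec.2
  hdriftF := (Pc.drift_of_orb inv.orbF hk).1
  hdriftG := (Pc.drift_of_orb inv.orbG hk).2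
  ε := Pc.eps k / 2
  hε := by have := Pc.eps_pos k; positivity

/-- **The comparison homeomorphism of a genuine stage has the step properties.** [folklore] -/
theorem stepProps_ΦK (k : ℕ) (F G : M ≃ₜ M) (inv : Pc.IterInv k F G) (pc : UPiece n M cD c₁ c₂)
    (hk : Pc.P k = some pc) : Pc.StepProps k (Pc.stageIn hn k F G inv pc hk).ΦK := by
  set I := Pc.stageIn hn k F G inv pc hk with hI
  refine { none := fun h => ?_, supp := fun pc' h' x hx => ?_, disp := fun x => ?_, img := fun pc' h' ℓ hℓ => ?_ }
  · rw [hk] at h; cases h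
  · rw [hk] at h'; cases Option.some.inj h'
    by_cases h5 : x ∈ I.P.MB 5
    · exact ⟨h5, I.ΦK_mem h5⟩
    · exact absurd (I.ΦK_eq_self h5) hx
  · letI := TopologicalSpace.metrizableSpaceMetric M
    by_cases h5 : x ∈ I.P.MB 5
    · -- chart displacement `≤ εb ≤ ε = eps k / 2 < eps k`, both points in `B 9`
      obtain ⟨hs, hle⟩ := I.norm_ΦK_sub_le h5
      have hx6 : I.ΦK x ∈ I.P.MB 6 := I.ΦK_mem h5
      have hw : I.P.ψ x ∈ pc.B 9 := pc.B_mono (by decide) ((pc.mem_MB_iff.1 h5).2)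
      have hw' : I.P.ψ (I.ΦK x) ∈ pc.B 9 := pc.B_mono (by decide) ((pc.mem_MB_iff.1 hx6).2)
      have hεb : I.εb < Pc.eps k := by
        have : I.εb ≤ I.ε := min_le_left _ _
        have hε : I.ε = Pc.eps k / 2 := rfl
        linarith [Pc.eps_pos k]
      have hd := Pc.eps_spec k pc hk _ hw' _ hw (by rw [dist_eq_norm]; exact hle.trans_lt hεb)
      change dist (pc.ψ.symm (pc.ψ (I.ΦK x))) (pc.ψ.symm (pc.ψ x)) < _ at hd
      rw [pc.ψ.left_inv hs, pc.ψ.left_inv (pc.MB_subset_source 5 h5)] at hd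
      exact hd.le
    · rw [I.ΦK_eq_self h5, dist_self]; exact Pc.lam_nonneg k
  · rw [hk] at h'; cases Option.some.inj h'
    exact I.ΦK_image_MB hℓ

/-- The same for the second comparison homeomorphism. [folklore] -/
theorem stepProps_ΦL (k : ℕ) (F G : M ≃ₜ M) (inv : Pc.IterInv k F G) (pc : UPiece n M cD c₁ c₂)
    (hk : Pc.P k = some pc) : Pc.StepProps k (Pc.stageIn hn k F G inv pc hk).ΦL := by
  set I := Pc.stageIn hn k F G inv pc hk with hI
  refine { none := fun h => ?_, supp := fun pc' h' x hx => ?_, disp := fun x => ?_, img := fun pc' h' ℓ hℓ => ?_ }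
  · rw [hk] at h; cases h
  · rw [hk] at h'; cases Option.some.inj h'
    by_cases h5 : x ∈ I.P.MB 5
    · exact ⟨h5, I.ΦL_mem h5⟩
    · exact absurd (I.ΦL_eq_self h5) hx
  · letI := TopologicalSpace.metrizableSpaceMetric M
    by_cases h5 : x ∈ I.P.MB 5
    · obtain ⟨hs, hle⟩ := I.norm_ΦL_sub_le h5
      have hx6 : I.ΦL x ∈ I.P.MB 6 := I.ΦL_mem h5
      have hw : I.P.ψ x ∈ pc.B 9 := pc.B_mono (by decide) ((pc.mem_MB_iff.1 h5).2)
      have hw' : I.P.ψ (I.ΦL x) ∈ pc.B 9 := pc.B_mono (by decide) ((pc.mem_MB_iff.1 hx6).2)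
      have hεb : I.εb < Pc.eps k := by
        have : I.εb ≤ I.ε := min_le_left _ _
        have hε : I.ε = Pc.eps k / 2 := rfl
        linarith [Pc.eps_pos k]
      have hd := Pc.eps_spec k pc hk _ hw' _ hw (by rw [dist_eq_norm]; exact hle.trans_lt hεb)
      change dist (pc.ψ.symm (pc.ψ (I.ΦL x))) (pc.ψ.symm (pc.ψ x)) < _ at hd
      rw [pc.ψ.left_inv hs, pc.ψ.left_inv (pc.MB_subset_source 5 h5)] at hd
      exact hd.le
    · rw [I.ΦL_eq_self h5, dist_self]; exact Pc.lam_nonneg k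
  · rw [hk] at h'; cases Option.some.inj h'
    exact I.ΦL_image_MB hℓ

/-- `compH` only depends on the first `k` maps. [folklore] -/
theorem compH_congr {Φ Φ' : ℕ → M ≃ₜ M} {k : ℕ} (h : ∀ t, t < k → Φ t = Φ' t) : compH Φ k = compH Φ' k := by
  induction k with
  | zero => rfl
  | succ k ih =>
    rw [compH_succ, compH_succ, ih fun t ht => h t (Nat.lt_succ_of_lt ht), h k (Nat.lt_succ_self k)]

/-- **Invariant propagation through a no-op stage.** [folklore] -/
theorem iterInv_step_none (k : ℕ) (F G : M ≃ₜ M) (inv : Pc.IterInv k F G) (hk : Pc.P k = none) :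
    Pc.IterInv (k + 1) F G := by
  have hAsucc : Pc.A (k + 1) (sl (k + 1)) ⊆ Pc.A k (sl k) := by
    rw [Pc.A_succ, Pc.core_none hk, union_empty]; exact Pc.A_mono_s k (sl_succ_lt k).le
  refine { pdF := inv.pdF, pdG := inv.pdG, pl := ?_, pl' := ?_, orbF := ?_, orbG := ?_ }
  · exact inv.pl.anti' ((Pc.isOpen_A (k + 1) (sl_le_one _)).preimage G.continuous) (preimage_mono hAsucc)
  · exact inv.pl'.anti' ((Pc.isOpen_A (k + 1) (sl_le_one _)).preimage F.continuous) (preimage_mono hAsucc)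
  · obtain ⟨Φ, hΦk, hF, hΦ⟩ := inv.orbF
    refine ⟨Φ, fun t ht => hΦk t (by omega), ?_, hΦ⟩
    rw [compH_succ, hΦk k le_rfl, ← hF]; rfl
  · obtain ⟨Φ, hΦk, hG, hΦ⟩ := inv.orbG
    refine ⟨Φ, fun t ht => hΦk t (by omega), ?_, hΦ⟩
    rw [compH_succ, hΦk k le_rfl, ← hG]; rfl

variable (hD : @IsManifold ℝ _ (𝔼 n) _ _ (𝔼 n) _ (𝓡 n) ∞ M _ cD)
  (h₁ : @IsPLManifold n hcomp haff M _ c₁) (h₂ : @IsPLManifold n hcomp haff M _ c₂)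

include hcomp haff Pc hn hD h₁ h₂

/-- **Invariant propagation through a genuine stage.** [cite: Munkres1966, Thm 10.5] -/
theorem iterInv_step_some (k : ℕ) (F G : M ≃ₜ M) (inv : Pc.IterInv k F G) (pc : UPiece n M cD c₁ c₂)
    (hk : Pc.P k = some pc) :
    Pc.IterInv (k + 1) (Pc.stageIn hn k F G inv pc hk).F' (Pc.stageIn hn k F G inv pc hk).G' := by
  set I := Pc.stageIn hn k F G inv pc hk with hI
  have hcore : Pc.core k (sl (k + 1)) ⊆ I.Nw := Pc.core_subset_ball hk (sl_le_one (k + 1))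
  have hAsucc : Pc.A (k + 1) (sl (k + 1)) ⊆ I.Am ∪ I.Nw := by
    rw [Pc.A_succ]; exact union_subset_union_right _ hcore
  refine { pdF := I.pdAlong_F' hcomp haff hD h₁, pdG := I.pdAlong_G' hcomp haff hD h₂, pl := ?_, pl' := ?_,
           orbF := ?_, orbG := ?_ }
  · exact (I.plAlongOn_h' hcomp haff h₁ h₂).anti' ((Pc.isOpen_A (k + 1) (sl_le_one _)).preimage I.G'.continuous)
      (preimage_mono hAsucc)
  · exact (I.plAlongOn_h'_symm hcomp haff h₁ h₂).anti' ((Pc.isOpen_A (k + 1) (sl_le_one _)).preimage I.F'.continuous)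
      (preimage_mono hAsucc)
  · obtain ⟨Φ, hΦk, hF, hΦ⟩ := inv.orbF
    refine ⟨Function.update Φ k I.ΦK, fun t ht => ?_, ?_, fun t => ?_⟩
    · rw [Function.update_of_ne (by omega)]; exact hΦk t (by omega)
    · show I.F.trans I.ΦK = (compH (Function.update Φ k I.ΦK) k).trans (Function.update Φ k I.ΦK k)
      rw [Function.update_self, ← compH_congr (fun t ht => (Function.update_of_ne (Nat.ne_of_lt ht) _ Φ).symm)]
      show F.trans I.ΦK = (compH Φ k).trans I.ΦK
      rw [hF]
    · by_cases ht : t = k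
      · subst ht; rw [Function.update_self]; exact Pc.stepProps_ΦK hn t F G inv pc hk
      · rw [Function.update_of_ne ht]; exact hΦ t
  · obtain ⟨Φ, hΦk, hG, hΦ⟩ := inv.orbG
    refine ⟨Function.update Φ k I.ΦL, fun t ht => ?_, ?_, fun t => ?_⟩
    · rw [Function.update_of_ne (by omega)]; exact hΦk t (by omega)
    · show I.G.trans I.ΦL = (compH (Function.update Φ k I.ΦL) k).trans (Function.update Φ k I.ΦL k)
      rw [Function.update_self, ← compH_congr (fun t ht => (Function.update_of_ne (Nat.ne_of_lt ht) _ Φ).symm)]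
      show G.trans I.ΦL = (compH Φ k).trans I.ΦL
      rw [hG]
    · by_cases ht : t = k
      · subst ht; rw [Function.update_self]; exact Pc.stepProps_ΦL hn t F G inv pc hk
      · rw [Function.update_of_ne ht]; exact hΦ t

variable (hc₁ : IsWhiteheadCompatible n M c₁ cD) (hc₂ : IsWhiteheadCompatible n M c₂ cD)

open Classical in
/-- One step of the induction on the bundled state. [folklore] -/
def step (k : ℕ) (st : {FG : (M ≃ₜ M) × (M ≃ₜ M) // Pc.IterInv k FG.1 FG.2}) :
    {FG : (M ≃ₜ M) × (M ≃ₜ M) // Pc.IterInv (k + 1) FG.1 FG.2} :=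
  if h : ∃ pc, Pc.P k = some pc then
    ⟨((Pc.stageIn hn k st.1.1 st.1.2 st.2 h.choose h.choose_spec).F',
      (Pc.stageIn hn k st.1.1 st.1.2 st.2 h.choose h.choose_spec).G'),
      Pc.iterInv_step_some hcomp haff hn hD h₁ h₂ k st.1.1 st.1.2 st.2 h.choose h.choose_spec⟩
  else
    ⟨st.1, Pc.iterInv_step_none k st.1.1 st.1.2 st.2 (by
      rcases hP : Pc.P k with _ | pc
      · rfl
      · exact (h ⟨pc, hP⟩).elim)⟩

include hc₁ hc₂

/-- **The states of the induction.** [cite: Munkres1966, Thm 10.5] -/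
def states : ∀ k : ℕ, {FG : (M ≃ₜ M) × (M ≃ₜ M) // Pc.IterInv k FG.1 FG.2}
  | 0 => ⟨(Homeomorph.refl M, Homeomorph.refl M), Pc.iterInv_zero hc₁ hc₂⟩
  | k + 1 => Pc.step hcomp haff hn hD h₁ h₂ k (states k)

/-- The first map at time `k`. [folklore] -/
def Fk (k : ℕ) : M ≃ₜ M := (Pc.states hcomp haff hn hD h₁ h₂ hc₁ hc₂ k).1.1

/-- The second map at time `k`. [folklore] -/
def Gk (k : ℕ) : M ≃ₜ M := (Pc.states hcomp haff hn hD h₁ h₂ hc₁ hc₂ k).1.2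

/-- The invariant holds at every time. [folklore] -/
theorem iterInv_states (k : ℕ) :
    Pc.IterInv k (Pc.Fk hcomp haff hn hD h₁ h₂ hc₁ hc₂ k) (Pc.Gk hcomp haff hn hD h₁ h₂ hc₁ hc₂ k) :=
  (Pc.states hcomp haff hn hD h₁ h₂ hc₁ hc₂ k).2

/-! #### The step relations -/

open Classical in
/-- The first maps along the recursion. [folklore] -/
theorem Fk_succ (k : ℕ) : Pc.Fk hcomp haff hn hD h₁ h₂ hc₁ hc₂ (k + 1) =
    if h : ∃ pc, Pc.P k = some pc then
      (Pc.stageIn hn k (Pc.Fk hcomp haff hn hD h₁ h₂ hc₁ hc₂ k) (Pc.Gk hcomp haff hn hD h₁ h₂ hc₁ hc₂ k)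
        (Pc.iterInv_states hcomp haff hn hD h₁ h₂ hc₁ hc₂ k) h.choose h.choose_spec).F'
    else Pc.Fk hcomp haff hn hD h₁ h₂ hc₁ hc₂ k := by
  classical
  show (Pc.step hcomp haff hn hD h₁ h₂ k (Pc.states hcomp haff hn hD h₁ h₂ hc₁ hc₂ k)).1.1 = _
  unfold step
  split_ifs <;> rfl

open Classical in
/-- The second maps along the recursion. [folklore] -/
theorem Gk_succ (k : ℕ) : Pc.Gk hcomp haff hn hD h₁ h₂ hc₁ hc₂ (k + 1) =
    if h : ∃ pc, Pc.P k = some pc then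
      (Pc.stageIn hn k (Pc.Fk hcomp haff hn hD h₁ h₂ hc₁ hc₂ k) (Pc.Gk hcomp haff hn hD h₁ h₂ hc₁ hc₂ k)
        (Pc.iterInv_states hcomp haff hn hD h₁ h₂ hc₁ hc₂ k) h.choose h.choose_spec).G'
    else Pc.Gk hcomp haff hn hD h₁ h₂ hc₁ hc₂ k := by
  classical
  show (Pc.step hcomp haff hn hD h₁ h₂ k (Pc.states hcomp haff hn hD h₁ h₂ hc₁ hc₂ k)).1.2 = _
  unfold step
  split_ifs <;> rfl

/-- A point moved by the first map at time `k` was mapped into `MB 5` of the piece. [folklore] -/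
theorem Fk_succ_ne {k : ℕ} {x : M}
    (h : Pc.Fk hcomp haff hn hD h₁ h₂ hc₁ hc₂ (k + 1) x ≠ Pc.Fk hcomp haff hn hD h₁ h₂ hc₁ hc₂ k x) :
    ∃ pc, Pc.P k = some pc ∧ Pc.Fk hcomp haff hn hD h₁ h₂ hc₁ hc₂ k x ∈ pc.MB 5 := by
  rw [Pc.Fk_succ] at h
  split_ifs at h with hP
  · refine ⟨hP.choose, hP.choose_spec, ?_⟩
    by_contra h5
    exact h (UStageIn.F'_eq _ h5)
  · exact absurd rfl h

/-- The same for the second map. [folklore] -/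
theorem Gk_succ_ne {k : ℕ} {x : M}
    (h : Pc.Gk hcomp haff hn hD h₁ h₂ hc₁ hc₂ (k + 1) x ≠ Pc.Gk hcomp haff hn hD h₁ h₂ hc₁ hc₂ k x) :
    ∃ pc, Pc.P k = some pc ∧ Pc.Gk hcomp haff hn hD h₁ h₂ hc₁ hc₂ k x ∈ pc.MB 5 := by
  rw [Pc.Gk_succ] at h
  split_ifs at h with hP
  · refine ⟨hP.choose, hP.choose_spec, ?_⟩
    by_contra h5
    exact h (UStageIn.G'_eq _ h5)
  · exact absurd rfl h

/-- A point moved by the inverse of the first map at time `k` lies in `MB 6` of the piece. [folklore] -/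
theorem Fk_symm_succ_ne {k : ℕ} {y : M}
    (h : (Pc.Fk hcomp haff hn hD h₁ h₂ hc₁ hc₂ (k + 1)).symm y ≠ (Pc.Fk hcomp haff hn hD h₁ h₂ hc₁ hc₂ k).symm y) :
    ∃ pc, Pc.P k = some pc ∧ y ∈ pc.MB 6 := by
  rw [Pc.Fk_succ] at h
  split_ifs at h with hP
  · refine ⟨hP.choose, hP.choose_spec, ?_⟩
    set I := Pc.stageIn hn k (Pc.Fk hcomp haff hn hD h₁ h₂ hc₁ hc₂ k) (Pc.Gk hcomp haff hn hD h₁ h₂ hc₁ hc₂ k)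
      (Pc.iterInv_states hcomp haff hn hD h₁ h₂ hc₁ hc₂ k) hP.choose hP.choose_spec with hI
    have hmove : I.ΦK.symm y ≠ y := by
      intro heq
      apply h
      show I.F.symm (I.ΦK.symm y) = _
      rw [heq]; rfl
    have hx : I.ΦK (I.ΦK.symm y) ≠ I.ΦK.symm y := by
      rw [Homeomorph.apply_symm_apply]; exact fun h' => hmove h'.symm
    have := ((Pc.stepProps_ΦK hn k _ _ (Pc.iterInv_states hcomp haff hn hD h₁ h₂ hc₁ hc₂ k) hP.choose hP.choose_spec).supp
      hP.choose hP.choose_spec _ hx).2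
    rwa [Homeomorph.apply_symm_apply] at this
  · exact absurd rfl h

/-- The same for the second map. [folklore] -/
theorem Gk_symm_succ_ne {k : ℕ} {y : M}
    (h : (Pc.Gk hcomp haff hn hD h₁ h₂ hc₁ hc₂ (k + 1)).symm y ≠ (Pc.Gk hcomp haff hn hD h₁ h₂ hc₁ hc₂ k).symm y) :
    ∃ pc, Pc.P k = some pc ∧ y ∈ pc.MB 6 := by
  rw [Pc.Gk_succ] at h
  split_ifs at h with hP
  · refine ⟨hP.choose, hP.choose_spec, ?_⟩
    set I := Pc.stageIn hn k (Pc.Fk hcomp haff hn hD h₁ h₂ hc₁ hc₂ k) (Pc.Gk hcomp haff hn hD h₁ h₂ hc₁ hc₂ k)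
      (Pc.iterInv_states hcomp haff hn hD h₁ h₂ hc₁ hc₂ k) hP.choose hP.choose_spec with hI
    have hmove : I.ΦL.symm y ≠ y := by
      intro heq
      apply h
      show I.G.symm (I.ΦL.symm y) = _
      rw [heq]; rfl
    have hx : I.ΦL (I.ΦL.symm y) ≠ I.ΦL.symm y := by
      rw [Homeomorph.apply_symm_apply]; exact fun h' => hmove h'.symm
    have := ((Pc.stepProps_ΦL hn k _ _ (Pc.iterInv_states hcomp haff hn hD h₁ h₂ hc₁ hc₂ k) hP.choose hP.choose_spec).supp
      hP.choose hP.choose_spec _ hx).2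
    rwa [Homeomorph.apply_symm_apply] at this
  · exact absurd rfl h

/-! #### Confinement and stabilisation -/

/-- Forward confinement of the first maps. [folklore] -/
theorem Fk_mem (k i : ℕ) {x : M} (hx : x ∈ Pc.K i) : Pc.Fk hcomp haff hn hD h₁ h₂ hc₁ hc₂ k x ∈ Pc.K (i + 1) := by
  obtain ⟨Φ, -, hF, hΦ⟩ := (Pc.iterInv_states hcomp haff hn hD h₁ h₂ hc₁ hc₂ k).orbF
  rw [hF]; exact Pc.compH_mem hΦ k i hx

/-- Forward confinement of the second maps. [folklore] -/
theorem Gk_mem (k i : ℕ) {x : M} (hx : x ∈ Pc.K i) : Pc.Gk hcomp haff hn hD h₁ h₂ hc₁ hc₂ k x ∈ Pc.K (i + 1) := by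
  obtain ⟨Φ, -, hG, hΦ⟩ := (Pc.iterInv_states hcomp haff hn hD h₁ h₂ hc₁ hc₂ k).orbG
  rw [hG]; exact Pc.compH_mem hΦ k i hx

/-- Backward confinement of the first maps. [folklore] -/
theorem Fk_symm_mem (k i : ℕ) {y : M} (hy : y ∈ Pc.K i) :
    (Pc.Fk hcomp haff hn hD h₁ h₂ hc₁ hc₂ k).symm y ∈ Pc.K (i + 1) := by
  obtain ⟨Φ, -, hF, hΦ⟩ := (Pc.iterInv_states hcomp haff hn hD h₁ h₂ hc₁ hc₂ k).orbF
  rw [hF]; exact Pc.compH_symm_mem hΦ k i hy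

/-- Backward confinement of the second maps. [folklore] -/
theorem Gk_symm_mem (k i : ℕ) {y : M} (hy : y ∈ Pc.K i) :
    (Pc.Gk hcomp haff hn hD h₁ h₂ hc₁ hc₂ k).symm y ∈ Pc.K (i + 1) := by
  obtain ⟨Φ, -, hG, hΦ⟩ := (Pc.iterInv_states hcomp haff hn hD h₁ h₂ hc₁ hc₂ k).orbG
  rw [hG]; exact Pc.compH_symm_mem hΦ k i hy

omit hcomp haff hn hD h₁ h₂ hc₁ hc₂ in
/-- **The stabilisation time of `K i`**: after it, no genuine piece has level `≤ i + 2`. [folklore] -/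
def Nst (i : ℕ) : ℕ := (Pc.hfin (i + 2)).toFinset.sup id + 1

omit hcomp haff hn hD h₁ h₂ hc₁ hc₂ in
/-- Auxiliary (`lev_gt_of_ge_Nst`). [folklore] -/
theorem lev_gt_of_ge_Nst {i k : ℕ} (hk : Pc.Nst i ≤ k) {pc : UPiece n M cD c₁ c₂} (hP : Pc.P k = some pc) :
    i + 2 < Pc.lev k := by
  by_contra hle
  push Not at hle
  have hmem : k ∈ (Pc.hfin (i + 2)).toFinset := (Pc.hfin (i + 2)).mem_toFinset.2 ⟨by rw [hP]; rfl, hle⟩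
  have := Finset.le_sup (f := id) hmem
  unfold Nst at hk
  simp only [id] at this
  omega

omit hcomp haff hn hD h₁ h₂ hc₁ hc₂ in
/-- Auxiliary (`Nst_mono`). [folklore] -/
theorem Nst_mono {i i' : ℕ} (h : i ≤ i') : Pc.Nst i ≤ Pc.Nst i' := by
  unfold Nst
  refine Nat.succ_le_succ (Finset.sup_mono fun k hk => ?_)
  obtain ⟨h1, h2⟩ := (Pc.hfin (i + 2)).mem_toFinset.1 hk
  exact (Pc.hfin (i' + 2)).mem_toFinset.2 ⟨h1, by omega⟩

omit hcomp haff hn hD h₁ h₂ hc₁ hc₂ in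
/-- After the stabilisation time of `K i`, genuine pieces do not meet `K (i+1)`. [folklore] -/
theorem notMem_of_ge_Nst {i k : ℕ} (hk : Pc.Nst i ≤ k) {pc : UPiece n M cD c₁ c₂} (hP : Pc.P k = some pc)
    {q : M} (hq : q ∈ pc.MB 9) : q ∉ Pc.K (i + 1) :=
  Set.disjoint_left.1 (Pc.hwin₂ k pc hP (i + 1) (by have := Pc.lev_gt_of_ge_Nst hk hP; omega)) hq

/-- **Stabilisation of the first maps on `K i`.** [folklore] -/
theorem Fk_eq_of_ge {i : ℕ} {x : M} (hx : x ∈ Pc.K i) {k : ℕ} (hk : Pc.Nst i ≤ k) :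
    Pc.Fk hcomp haff hn hD h₁ h₂ hc₁ hc₂ k x = Pc.Fk hcomp haff hn hD h₁ h₂ hc₁ hc₂ (Pc.Nst i) x := by
  induction k with
  | zero => rw [Nat.le_zero.1 hk]
  | succ k ih =>
    rcases hk.lt_or_eq with hlt | heq
    · have hk' : Pc.Nst i ≤ k := Nat.lt_succ_iff.1 hlt
      rw [← ih hk']
      by_contra hne
      obtain ⟨pc, hP, h5⟩ := Pc.Fk_succ_ne hcomp haff hn hD h₁ h₂ hc₁ hc₂ hne
      exact Pc.notMem_of_ge_Nst hk' hP (pc.MB_mono (by decide) h5) (Pc.Fk_mem hcomp haff hn hD h₁ h₂ hc₁ hc₂ k i hx)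
    · rw [heq]

/-- **Stabilisation of the second maps on `K i`.** [folklore] -/
theorem Gk_eq_of_ge {i : ℕ} {x : M} (hx : x ∈ Pc.K i) {k : ℕ} (hk : Pc.Nst i ≤ k) :
    Pc.Gk hcomp haff hn hD h₁ h₂ hc₁ hc₂ k x = Pc.Gk hcomp haff hn hD h₁ h₂ hc₁ hc₂ (Pc.Nst i) x := by
  induction k with
  | zero => rw [Nat.le_zero.1 hk]
  | succ k ih =>
    rcases hk.lt_or_eq with hlt | heq
    · have hk' : Pc.Nst i ≤ k := Nat.lt_succ_iff.1 hlt
      rw [← ih hk']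
      by_contra hne
      obtain ⟨pc, hP, h5⟩ := Pc.Gk_succ_ne hcomp haff hn hD h₁ h₂ hc₁ hc₂ hne
      exact Pc.notMem_of_ge_Nst hk' hP (pc.MB_mono (by decide) h5) (Pc.Gk_mem hcomp haff hn hD h₁ h₂ hc₁ hc₂ k i hx)
    · rw [heq]

/-- **Stabilisation of the inverses of the first maps on `K i`.** [folklore] -/
theorem Fk_symm_eq_of_ge {i : ℕ} {y : M} (hy : y ∈ Pc.K i) {k : ℕ} (hk : Pc.Nst i ≤ k) :
    (Pc.Fk hcomp haff hn hD h₁ h₂ hc₁ hc₂ k).symm y = (Pc.Fk hcomp haff hn hD h₁ h₂ hc₁ hc₂ (Pc.Nst i)).symm y := by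
  induction k with
  | zero => rw [Nat.le_zero.1 hk]
  | succ k ih =>
    rcases hk.lt_or_eq with hlt | heq
    · have hk' : Pc.Nst i ≤ k := Nat.lt_succ_iff.1 hlt
      rw [← ih hk']
      by_contra hne
      obtain ⟨pc, hP, h6⟩ := Pc.Fk_symm_succ_ne hcomp haff hn hD h₁ h₂ hc₁ hc₂ hne
      exact Pc.notMem_of_ge_Nst hk' hP (pc.MB_mono (by decide) h6) (Pc.K.subset_succ i hy)
    · rw [heq]

/-- **Stabilisation of the inverses of the second maps on `K i`.** [folklore] -/
theorem Gk_symm_eq_of_ge {i : ℕ} {y : M} (hy : y ∈ Pc.K i) {k : ℕ} (hk : Pc.Nst i ≤ k) :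
    (Pc.Gk hcomp haff hn hD h₁ h₂ hc₁ hc₂ k).symm y = (Pc.Gk hcomp haff hn hD h₁ h₂ hc₁ hc₂ (Pc.Nst i)).symm y := by
  induction k with
  | zero => rw [Nat.le_zero.1 hk]
  | succ k ih =>
    rcases hk.lt_or_eq with hlt | heq
    · have hk' : Pc.Nst i ≤ k := Nat.lt_succ_iff.1 hlt
      rw [← ih hk']
      by_contra hne
      obtain ⟨pc, hP, h6⟩ := Pc.Gk_symm_succ_ne hcomp haff hn hD h₁ h₂ hc₁ hc₂ hne
      exact Pc.notMem_of_ge_Nst hk' hP (pc.MB_mono (by decide) h6) (Pc.K.subset_succ i hy)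
    · rw [heq]

/-! #### The limit homeomorphisms -/

/-- The limit of the first maps. [folklore] -/
def Finf (x : M) : M := Pc.Fk hcomp haff hn hD h₁ h₂ hc₁ hc₂ (Pc.Nst (Pc.K.find x)) x

/-- The limit of the inverses of the first maps. [folklore] -/
def Finv (y : M) : M := (Pc.Fk hcomp haff hn hD h₁ h₂ hc₁ hc₂ (Pc.Nst (Pc.K.find y))).symm y

/-- The limit of the second maps. [folklore] -/
def Ginf (x : M) : M := Pc.Gk hcomp haff hn hD h₁ h₂ hc₁ hc₂ (Pc.Nst (Pc.K.find x)) x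

/-- The limit of the inverses of the second maps. [folklore] -/
def Ginv (y : M) : M := (Pc.Gk hcomp haff hn hD h₁ h₂ hc₁ hc₂ (Pc.Nst (Pc.K.find y))).symm y

/-- **Eventual equality with the limit** on `K i`. [folklore] -/
theorem Fk_eq_Finf {i : ℕ} {x : M} (hx : x ∈ Pc.K i) {k : ℕ} (hk : Pc.Nst i ≤ k) :
    Pc.Fk hcomp haff hn hD h₁ h₂ hc₁ hc₂ k x = Pc.Finf hcomp haff hn hD h₁ h₂ hc₁ hc₂ x := by
  rw [Pc.Fk_eq_of_ge hcomp haff hn hD h₁ h₂ hc₁ hc₂ hx hk]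
  exact Pc.Fk_eq_of_ge hcomp haff hn hD h₁ h₂ hc₁ hc₂ (Pc.K.mem_find x) (Pc.Nst_mono (Pc.K.mem_iff_find_le.1 hx))

/-- The same for the second maps. [folklore] -/
theorem Gk_eq_Ginf {i : ℕ} {x : M} (hx : x ∈ Pc.K i) {k : ℕ} (hk : Pc.Nst i ≤ k) :
    Pc.Gk hcomp haff hn hD h₁ h₂ hc₁ hc₂ k x = Pc.Ginf hcomp haff hn hD h₁ h₂ hc₁ hc₂ x := by
  rw [Pc.Gk_eq_of_ge hcomp haff hn hD h₁ h₂ hc₁ hc₂ hx hk]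
  exact Pc.Gk_eq_of_ge hcomp haff hn hD h₁ h₂ hc₁ hc₂ (Pc.K.mem_find x) (Pc.Nst_mono (Pc.K.mem_iff_find_le.1 hx))

/-- The same for the inverses of the first maps. [folklore] -/
theorem Fk_symm_eq_Finv {i : ℕ} {y : M} (hy : y ∈ Pc.K i) {k : ℕ} (hk : Pc.Nst i ≤ k) :
    (Pc.Fk hcomp haff hn hD h₁ h₂ hc₁ hc₂ k).symm y = Pc.Finv hcomp haff hn hD h₁ h₂ hc₁ hc₂ y := by
  rw [Pc.Fk_symm_eq_of_ge hcomp haff hn hD h₁ h₂ hc₁ hc₂ hy hk]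
  exact Pc.Fk_symm_eq_of_ge hcomp haff hn hD h₁ h₂ hc₁ hc₂ (Pc.K.mem_find y) (Pc.Nst_mono (Pc.K.mem_iff_find_le.1 hy))

/-- The same for the inverses of the second maps. [folklore] -/
theorem Gk_symm_eq_Ginv {i : ℕ} {y : M} (hy : y ∈ Pc.K i) {k : ℕ} (hk : Pc.Nst i ≤ k) :
    (Pc.Gk hcomp haff hn hD h₁ h₂ hc₁ hc₂ k).symm y = Pc.Ginv hcomp haff hn hD h₁ h₂ hc₁ hc₂ y := by
  rw [Pc.Gk_symm_eq_of_ge hcomp haff hn hD h₁ h₂ hc₁ hc₂ hy hk]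
  exact Pc.Gk_symm_eq_of_ge hcomp haff hn hD h₁ h₂ hc₁ hc₂ (Pc.K.mem_find y) (Pc.Nst_mono (Pc.K.mem_iff_find_le.1 hy))

/-- **The limit of the first maps is a homeomorphism of `M`** (mutually inverse eventually constant
limits, continuous on the interiors of the `K i`). [cite: Munkres1966, Thm 10.4] -/
def FinfH : M ≃ₜ M where
  toFun := Pc.Finf hcomp haff hn hD h₁ h₂ hc₁ hc₂
  invFun := Pc.Finv hcomp haff hn hD h₁ h₂ hc₁ hc₂
  left_inv x := by
    obtain ⟨k, hk1, hk2⟩ : ∃ k, Pc.Nst (Pc.K.find x) ≤ k ∧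
        Pc.Nst (Pc.K.find (Pc.Finf hcomp haff hn hD h₁ h₂ hc₁ hc₂ x)) ≤ k := ⟨max _ _, le_max_left _ _, le_max_right _ _⟩
    have h1 := Pc.Fk_eq_Finf hcomp haff hn hD h₁ h₂ hc₁ hc₂ (Pc.K.mem_find x) hk1
    have h2 := Pc.Fk_symm_eq_Finv hcomp haff hn hD h₁ h₂ hc₁ hc₂ (Pc.K.mem_find (Pc.Finf hcomp haff hn hD h₁ h₂ hc₁ hc₂ x)) hk2
    calc Pc.Finv hcomp haff hn hD h₁ h₂ hc₁ hc₂ (Pc.Finf hcomp haff hn hD h₁ h₂ hc₁ hc₂ x)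
        = (Pc.Fk hcomp haff hn hD h₁ h₂ hc₁ hc₂ k).symm (Pc.Finf hcomp haff hn hD h₁ h₂ hc₁ hc₂ x) := h2.symm
      _ = (Pc.Fk hcomp haff hn hD h₁ h₂ hc₁ hc₂ k).symm (Pc.Fk hcomp haff hn hD h₁ h₂ hc₁ hc₂ k x) := by rw [h1]
      _ = x := Homeomorph.symm_apply_apply _ _
  right_inv y := by
    obtain ⟨k, hk1, hk2⟩ : ∃ k, Pc.Nst (Pc.K.find y) ≤ k ∧
        Pc.Nst (Pc.K.find (Pc.Finv hcomp haff hn hD h₁ h₂ hc₁ hc₂ y)) ≤ k := ⟨max _ _, le_max_left _ _, le_max_right _ _⟩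
    have h2 := Pc.Fk_symm_eq_Finv hcomp haff hn hD h₁ h₂ hc₁ hc₂ (Pc.K.mem_find y) hk1
    have h1 := Pc.Fk_eq_Finf hcomp haff hn hD h₁ h₂ hc₁ hc₂ (Pc.K.mem_find (Pc.Finv hcomp haff hn hD h₁ h₂ hc₁ hc₂ y)) hk2
    calc Pc.Finf hcomp haff hn hD h₁ h₂ hc₁ hc₂ (Pc.Finv hcomp haff hn hD h₁ h₂ hc₁ hc₂ y)
        = Pc.Fk hcomp haff hn hD h₁ h₂ hc₁ hc₂ k (Pc.Finv hcomp haff hn hD h₁ h₂ hc₁ hc₂ y) := h1.symm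
      _ = Pc.Fk hcomp haff hn hD h₁ h₂ hc₁ hc₂ k ((Pc.Fk hcomp haff hn hD h₁ h₂ hc₁ hc₂ k).symm y) := by rw [h2]
      _ = y := Homeomorph.apply_symm_apply _ _
  continuous_toFun := by
    rw [continuous_iff_continuousAt]
    intro x
    set i := Pc.K.find x + 1 with hi
    have hx : x ∈ interior (Pc.K i) := Pc.K.subset_interior_succ _ (Pc.K.mem_find x)
    refine (Pc.Fk hcomp haff hn hD h₁ h₂ hc₁ hc₂ (Pc.Nst i)).continuous.continuousAt.congr ?_
    filter_upwards [isOpen_interior.mem_nhds hx] with x' hx'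
    exact Pc.Fk_eq_Finf hcomp haff hn hD h₁ h₂ hc₁ hc₂ (interior_subset hx') le_rfl
  continuous_invFun := by
    rw [continuous_iff_continuousAt]
    intro y
    set i := Pc.K.find y + 1 with hi
    have hy : y ∈ interior (Pc.K i) := Pc.K.subset_interior_succ _ (Pc.K.mem_find y)
    refine (Pc.Fk hcomp haff hn hD h₁ h₂ hc₁ hc₂ (Pc.Nst i)).symm.continuous.continuousAt.congr ?_
    filter_upwards [isOpen_interior.mem_nhds hy] with y' hy'
    exact Pc.Fk_symm_eq_Finv hcomp haff hn hD h₁ h₂ hc₁ hc₂ (interior_subset hy') le_rfl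

/-- **The limit of the second maps is a homeomorphism of `M`.** [cite: Munkres1966, Thm 10.4] -/
def GinfH : M ≃ₜ M where
  toFun := Pc.Ginf hcomp haff hn hD h₁ h₂ hc₁ hc₂
  invFun := Pc.Ginv hcomp haff hn hD h₁ h₂ hc₁ hc₂
  left_inv x := by
    obtain ⟨k, hk1, hk2⟩ : ∃ k, Pc.Nst (Pc.K.find x) ≤ k ∧
        Pc.Nst (Pc.K.find (Pc.Ginf hcomp haff hn hD h₁ h₂ hc₁ hc₂ x)) ≤ k := ⟨max _ _, le_max_left _ _, le_max_right _ _⟩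
    have h1 := Pc.Gk_eq_Ginf hcomp haff hn hD h₁ h₂ hc₁ hc₂ (Pc.K.mem_find x) hk1
    have h2 := Pc.Gk_symm_eq_Ginv hcomp haff hn hD h₁ h₂ hc₁ hc₂ (Pc.K.mem_find (Pc.Ginf hcomp haff hn hD h₁ h₂ hc₁ hc₂ x)) hk2
    calc Pc.Ginv hcomp haff hn hD h₁ h₂ hc₁ hc₂ (Pc.Ginf hcomp haff hn hD h₁ h₂ hc₁ hc₂ x)
        = (Pc.Gk hcomp haff hn hD h₁ h₂ hc₁ hc₂ k).symm (Pc.Ginf hcomp haff hn hD h₁ h₂ hc₁ hc₂ x) := h2.symm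
      _ = (Pc.Gk hcomp haff hn hD h₁ h₂ hc₁ hc₂ k).symm (Pc.Gk hcomp haff hn hD h₁ h₂ hc₁ hc₂ k x) := by rw [h1]
      _ = x := Homeomorph.symm_apply_apply _ _
  right_inv y := by
    obtain ⟨k, hk1, hk2⟩ : ∃ k, Pc.Nst (Pc.K.find y) ≤ k ∧
        Pc.Nst (Pc.K.find (Pc.Ginv hcomp haff hn hD h₁ h₂ hc₁ hc₂ y)) ≤ k := ⟨max _ _, le_max_left _ _, le_max_right _ _⟩
    have h2 := Pc.Gk_symm_eq_Ginv hcomp haff hn hD h₁ h₂ hc₁ hc₂ (Pc.K.mem_find y) hk1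
    have h1 := Pc.Gk_eq_Ginf hcomp haff hn hD h₁ h₂ hc₁ hc₂ (Pc.K.mem_find (Pc.Ginv hcomp haff hn hD h₁ h₂ hc₁ hc₂ y)) hk2
    calc Pc.Ginf hcomp haff hn hD h₁ h₂ hc₁ hc₂ (Pc.Ginv hcomp haff hn hD h₁ h₂ hc₁ hc₂ y)
        = Pc.Gk hcomp haff hn hD h₁ h₂ hc₁ hc₂ k (Pc.Ginv hcomp haff hn hD h₁ h₂ hc₁ hc₂ y) := h1.symm
      _ = Pc.Gk hcomp haff hn hD h₁ h₂ hc₁ hc₂ k ((Pc.Gk hcomp haff hn hD h₁ h₂ hc₁ hc₂ k).symm y) := by rw [h2]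
      _ = y := Homeomorph.apply_symm_apply _ _
  continuous_toFun := by
    rw [continuous_iff_continuousAt]
    intro x
    set i := Pc.K.find x + 1 with hi
    have hx : x ∈ interior (Pc.K i) := Pc.K.subset_interior_succ _ (Pc.K.mem_find x)
    refine (Pc.Gk hcomp haff hn hD h₁ h₂ hc₁ hc₂ (Pc.Nst i)).continuous.continuousAt.congr ?_
    filter_upwards [isOpen_interior.mem_nhds hx] with x' hx'
    exact Pc.Gk_eq_Ginf hcomp haff hn hD h₁ h₂ hc₁ hc₂ (interior_subset hx') le_rfl
  continuous_invFun := by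
    rw [continuous_iff_continuousAt]
    intro y
    set i := Pc.K.find y + 1 with hi
    have hy : y ∈ interior (Pc.K i) := Pc.K.subset_interior_succ _ (Pc.K.mem_find y)
    refine (Pc.Gk hcomp haff hn hD h₁ h₂ hc₁ hc₂ (Pc.Nst i)).symm.continuous.continuousAt.congr ?_
    filter_upwards [isOpen_interior.mem_nhds hy] with y' hy'
    exact Pc.Gk_symm_eq_Ginv hcomp haff hn hD h₁ h₂ hc₁ hc₂ (interior_subset hy') le_rfl

/-! #### The limit comparison map is PL in both directions everywhere -/

/-- **`G∞.trans F∞.symm` is PL along `(c₂, c₁)` on all of `M`.** [cite: Munkres1966, Thm 10.5] -/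
theorem plAlongOn_inf :
    PLAlongOn n c₂ c₁ ((Pc.GinfH hcomp haff hn hD h₁ h₂ hc₁ hc₂).trans (Pc.FinfH hcomp haff hn hD h₁ h₂ hc₁ hc₂).symm) univ := by
  set FH := Pc.FinfH hcomp haff hn hD h₁ h₂ hc₁ hc₂ with hFH
  set GH := Pc.GinfH hcomp haff hn hD h₁ h₂ hc₁ hc₂ with hGH
  have key : ∀ p : M, ∃ V : Set M, p ∈ V ∧ PLAlongOn n c₂ c₁ (GH.trans FH.symm) V := by
    intro p
    obtain ⟨j, pc, hj, hpj⟩ := Pc.hcover (GH p)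
    set i := Pc.K.find p + 1 with hi
    set k := max (max (Pc.Nst i) (Pc.Nst (i + 1))) (j + 1) with hk
    have hki : Pc.Nst i ≤ k := (le_max_left _ _).trans (le_max_left _ _)
    have hki' : Pc.Nst (i + 1) ≤ k := (le_max_right _ _).trans (le_max_left _ _)
    have hkj : j < k := Nat.lt_of_lt_of_le (Nat.lt_succ_self j) (le_max_right _ _)
    have hpi : p ∈ interior (Pc.K i) := Pc.K.subset_interior_succ _ (Pc.K.mem_find p)
    set F := Pc.Fk hcomp haff hn hD h₁ h₂ hc₁ hc₂ k with hF
    set G := Pc.Gk hcomp haff hn hD h₁ h₂ hc₁ hc₂ k with hG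
    have heqG : ∀ q ∈ interior (Pc.K i), GH q = G q := fun q hq =>
      (Pc.Gk_eq_Ginf hcomp haff hn hD h₁ h₂ hc₁ hc₂ (interior_subset hq) hki).symm
    have heq : ∀ q ∈ interior (Pc.K i), (GH.trans FH.symm) q = (G.trans F.symm) q := by
      intro q hq
      show FH.symm (GH q) = F.symm (G q)
      rw [heqG q hq]
      exact (Pc.Fk_symm_eq_Finv hcomp haff hn hD h₁ h₂ hc₁ hc₂
        (Pc.Gk_mem hcomp haff hn hD h₁ h₂ hc₁ hc₂ k i (interior_subset hq)) hki').symm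
    have hPL := (Pc.iterInv_states hcomp haff hn hD h₁ h₂ hc₁ hc₂ k).pl
    have hV := hPL.congr_inter ((Pc.isOpen_A k (sl_le_one k)).preimage G.continuous) isOpen_interior heq
    refine ⟨G ⁻¹' Pc.A k (sl k) ∩ interior (Pc.K i), ⟨?_, hpi⟩, hV⟩
    show G p ∈ Pc.A k (sl k)
    rw [← heqG p hpi]
    exact Pc.mem_A_iff.2 ⟨j, hkj, Pc.MB_subset_core hj (sl_pos k) hpj⟩
  choose V hpV hV using key
  exact (plAlongOn_iUnion hV).anti' isOpen_univ fun p _ => mem_iUnion.2 ⟨p, hpV p⟩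

/-- **Its inverse is PL along `(c₁, c₂)` on all of `M`.** [cite: Munkres1966, Thm 10.5] -/
theorem plAlongOn_inf_symm :
    PLAlongOn n c₁ c₂ ((Pc.GinfH hcomp haff hn hD h₁ h₂ hc₁ hc₂).trans (Pc.FinfH hcomp haff hn hD h₁ h₂ hc₁ hc₂).symm).symm univ := by
  set FH := Pc.FinfH hcomp haff hn hD h₁ h₂ hc₁ hc₂ with hFH
  set GH := Pc.GinfH hcomp haff hn hD h₁ h₂ hc₁ hc₂ with hGH
  have key : ∀ p : M, ∃ V : Set M, p ∈ V ∧ PLAlongOn n c₁ c₂ (GH.trans FH.symm).symm V := by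
    intro p
    obtain ⟨j, pc, hj, hpj⟩ := Pc.hcover (FH p)
    set i := Pc.K.find p + 1 with hi
    set k := max (max (Pc.Nst i) (Pc.Nst (i + 1))) (j + 1) with hk
    have hki : Pc.Nst i ≤ k := (le_max_left _ _).trans (le_max_left _ _)
    have hki' : Pc.Nst (i + 1) ≤ k := (le_max_right _ _).trans (le_max_left _ _)
    have hkj : j < k := Nat.lt_of_lt_of_le (Nat.lt_succ_self j) (le_max_right _ _)
    have hpi : p ∈ interior (Pc.K i) := Pc.K.subset_interior_succ _ (Pc.K.mem_find p)
    set F := Pc.Fk hcomp haff hn hD h₁ h₂ hc₁ hc₂ k with hF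
    set G := Pc.Gk hcomp haff hn hD h₁ h₂ hc₁ hc₂ k with hG
    have heqF : ∀ q ∈ interior (Pc.K i), FH q = F q := fun q hq =>
      (Pc.Fk_eq_Finf hcomp haff hn hD h₁ h₂ hc₁ hc₂ (interior_subset hq) hki).symm
    have heq : ∀ q ∈ interior (Pc.K i), (GH.trans FH.symm).symm q = (F.trans G.symm) q := by
      intro q hq
      show GH.symm (FH q) = G.symm (F q)
      rw [heqF q hq]
      exact (Pc.Gk_symm_eq_Ginv hcomp haff hn hD h₁ h₂ hc₁ hc₂
        (Pc.Fk_mem hcomp haff hn hD h₁ h₂ hc₁ hc₂ k i (interior_subset hq)) hki').symm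
    have hPL := (Pc.iterInv_states hcomp haff hn hD h₁ h₂ hc₁ hc₂ k).pl'
    have hV := hPL.congr_inter ((Pc.isOpen_A k (sl_le_one k)).preimage F.continuous) isOpen_interior heq
    refine ⟨F ⁻¹' Pc.A k (sl k) ∩ interior (Pc.K i), ⟨?_, hpi⟩, hV⟩
    show F p ∈ Pc.A k (sl k)
    rw [← heqF p hpi]
    exact Pc.mem_A_iff.2 ⟨j, hkj, Pc.MB_subset_core hj (sl_pos k) hpj⟩
  choose V hpV hV using key
  exact (plAlongOn_iUnion hV).anti' isOpen_univ fun p _ => mem_iUnion.2 ⟨p, hpV p⟩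

/-- **The conclusion in positive dimension**: a PL homeomorphism `(M, c₁) → (M, c₂)`.
[cite: Munkres1966, Thm 10.5] -/
theorem nonempty_structomorph :
    Nonempty (@Structomorph (𝔼 n) _ (plGroupoid n hcomp haff) M M _ _ c₁ c₂) := by
  exact nonempty_structomorph_of_plAlongOn n hcomp haff (c₁ := c₁) (c₂ := c₂)
    ((Pc.GinfH hcomp haff hn hD h₁ h₂ hc₁ hc₂).trans (Pc.FinfH hcomp haff hn hD h₁ h₂ hc₁ hc₂).symm).symm
    (Pc.plAlongOn_inf_symm hcomp haff hn hD h₁ h₂ hc₁ hc₂) (Pc.plAlongOn_inf hcomp haff hn hD h₁ h₂ hc₁ hc₂)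

end Induction

end UPieces

/-! ### The theorem -/

section Final

/-- **Dimension zero**: every map of `ℝ⁰` is PL on every set (the one-vertex complex). [folklore] -/
theorem isPLOn_of_dim_zero {f : 𝔼 0 → 𝔼 0} {u : Set (𝔼 0)} : IsPLOn 0 0 f u := by
  classical
  intro a ha
  haveI hE : Subsingleton (𝔼 0) := by
    refine ⟨fun x y => ?_⟩
    ext i; exact i.elim0
  haveI : Subsingleton ↥(({a} : Finset (𝔼 0)) : Set (𝔼 0)) := ⟨fun x y => Subtype.ext (Subsingleton.elim _ _)⟩
  let K : Geometry.SimplicialComplex ℝ (𝔼 0) :=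
    { faces := {{a}}
      indep := by
        rintro s hs
        rw [mem_singleton_iff] at hs; subst hs
        exact affineIndependent_of_subsingleton ℝ _
      isRelLowerSet_faces := by
        rintro s hs
        rw [mem_singleton_iff] at hs; subst hs
        exact ⟨Finset.singleton_nonempty _, fun t ht hne => by
          rw [mem_singleton_iff]; exact hne.subset_singleton_iff.1 ht⟩
      inter_subset_convexHull := by
        rintro s t hs ht
        rw [mem_singleton_iff] at hs ht; subst hs; subst ht
        intro x hx; simpa using hx }
  have hspace : K.space = univ := by
    refine eq_univ_of_forall fun x => Geometry.SimplicialComplex.mem_space_iff.2 ⟨{a}, rfl, ?_⟩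
    rw [Subsingleton.elim x a]; exact subset_convexHull ℝ _ (by simp)
  refine ⟨K, Set.finite_singleton _, by rw [hspace]; exact univ_mem, fun x _ => by rw [Subsingleton.elim x a]; exact ha,
    fun s hs => ?_⟩
  rw [show s = {a} from hs]
  refine ⟨AffineMap.const ℝ (𝔼 0) (f a), fun x _ => ?_⟩
  rw [Subsingleton.elim x a]; rfl

/-- **Whitehead's uniqueness theorem** (Munkres (1966), Thm 10.5; Whitehead (1940), Thm 8): two PL
structures on the space of a smooth manifold which are both Whitehead compatible with the smooth
structure are PL homeomorphic. Discharge of the named fact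
`nonempty_plHomeomorph_of_isWhiteheadCompatible`. [cite: Munkres1966, Thm 10.5] -/
theorem nonempty_plHomeomorph_of_isWhiteheadCompatible_holds (n : ℕ) (hcomp : IsPLOn.comp (n := n))
    (haff : isPLOn_affineMap (n := n) (m := n)) : nonempty_plHomeomorph_of_isWhiteheadCompatible n hcomp haff := by
  intro M _ _ _ cD hD c₁ c₂ h₁ h₂ hc₁ hc₂
  rcases Nat.eq_zero_or_pos n with rfl | hn
  · refine ⟨@Structomorph.mk (𝔼 0) _ (plGroupoid 0 hcomp haff) M M _ _ c₁ c₂ (Homeomorph.refl M) fun c c' _ _ => ?_⟩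
    rw [mem_plGroupoid_iff]
    exact ⟨isPLOn_of_dim_zero, isPLOn_of_dim_zero⟩
  · haveI : LocallyCompactSpace M := ChartedSpace.locallyCompactSpace (𝔼 n) M
    haveI : SigmaCompactSpace M := sigmaCompactSpace_of_locallyCompact_secondCountable
    haveI : TopologicalSpace.MetrizableSpace M := Manifold.metrizableSpace (𝓡 n) M
    obtain ⟨Pc⟩ := exists_uPieces cD c₁ c₂
    exact Pc.nonempty_structomorph hcomp haff hn hD h₁ h₂ hc₁ hc₂

end Final

end Literature.Topology.FourManifolds
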